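import Mathlib

/-!
# `BalabanImbrieJaffe1984to88.BIJ85Sect2SurfaceAverages` — T. Bałaban, J. Imbrie, A. Jaffe, *Renormalization of the Higgs
model: minimizers, propagators and the stability of mean field theory*, Commun. Math. Phys. **97** (1985) 299–329
[BalabanImbrieJaffe1985]: the surface-bond averages (2.15)–(2.18) of Sect. 2 and the group-valued pull-back
(4.5.1)–(4.5.3) of Sect. 4.5 — the object B14 = [Balaban1988Convergent] p. 246 cites as "Q₁^{s*}V … introduced in (4.5.3) [18]"

statement-level skeleton of published theorems with citation tags; proofs where landed; nothing here is a claim about the Yang–Mills mass gap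

PDF held: `paper:balaban1985-cmp97-bij-higgs-minimizers` (journal page = PDF page + 298).  Renders read as images:
`run/sessions/…/pages/1985-cmp97-bij-higgs-minimizers-p006-x2.png` (p. 304) and `…-p014-x2.png` (p. 312), made with
`pub-balaban/b2b-balaban-ref1/tools/g4png.py` from `pub-balaban/inputs/files/context/1985-cmp97-bij-higgs-minimizers.pdf`
(copies in `run/shared/lean/pub/lit-balaban/lit-balaban-r15/pages/`).

CITATION HEADER (lean-in-tree rule).  Part of the lit-balaban TYPED SKELETON (HOME `run/shared/lean/pub/lit-balaban/`; rows
C1.Eq2.15 … C1.Eq2.18, C1.Eq4.5.1 … C1.Eq4.5.3 of `HOME/lit-balaban-r15/ROWS-C1-part2.md`).  WHAT IS REPRODUCED, and how: over an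
explicit two-scale bond geometry (`BlockBonds`: fine sites/bonds, coarse sites/bonds, the block map x ↦ y with x ∈ B(y), the block
size L and dimension d; the two printed geometric facts used — a coarse bond is determined by its endpoints, and (for (2.18)) every
surface set has L^{d−1} bonds — are explicit hypotheses where needed), the DEFINITIONS (2.15) (surface bonds B^s(b′)), (2.16)
(Q^s), (2.17) (Q^{s*}, typed as the sum over coarse bonds of the printed case formula, which has at most one non-zero term) and the
projection P^s of (2.18), all with bodies; PROVED: the printed case formula (2.17) (`Qsstar_of_mem`, `Qsstar_of_not_mem`), that
(2.17) IS the adjoint of (2.16) for the inner products (2.14) ⟨A,B⟩_a = Σ_b a^d A_b B_b with a = 1 on the fine and a = L on the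
coarse lattice (`inner_Qs_eq_inner_Qsstar`), and **(2.18)** Q^sQ^{s*} = L·I (`Qs_Qsstar`), Q^{s*}Q^s = L·P^s (`Qsstar_Qs`); and
the group-valued extension **(4.5.1)–(4.5.3)** p. 312 for the k-fold geometry (block size L^k, fine spacing η with ηL^k = 1):
(4.5.2) as a definition and the printed "equivalent definition" (4.5.3) PROVED from it (`eq453_interior`, `eq453_corridor`).
NOT here: (2.13) (the bond average Q, typed in the Bałaban tree as `…Balaban1983to89.B5Block118.QvOp` / cited in
`…Federbush1986.AbelianStability`), (2.19)–(2.24) (edge plaquettes, Q^e) — rows only (reader r17's Sects. 1–3).  NOTHING beyond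
the kernel-checked statements is asserted.  Unit `lit-balaban-r15` (second reader of C1 per SKELETON.md §1 Rule 3).

v1.1 (append-only, reader/typer r15 gen 2; row C1.Eq4.5.4): **(4.5.4)** p. 313 [PDF 15], the background gauge field
(u_k)_b = (Q^{s*}_kv)_b exp[−ie_kη(𝒟_k∂^*Q^{e*}_kf^{(k)})_b] — `BlockBonds.backgroundField` (def with body over `QsstarGroup`; the real
η-lattice bond field 𝒟_k∂^*Q^{e*}_kf^{(k)} — the Landau-gauge minimizer (4.4.4) applied to ∂^*Q^{e*}_kf^{(k)}, objects of Sects. 4.2–4.4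
not carried by `BlockBonds` — enters as the argument `X`), with PROVED: the Lie-algebra form u_k = exp(ie_kη(Q^{s*}_kB − X))
(`backgroundField_eq_exp`), ∣(u_k)_b∣ = 1 (`norm_backgroundField`), and the two cases of (4.5.3) inserted (`backgroundField_interior`,
`backgroundField_corridor`).
-/

namespace Literature.MathematicalPhysics.QuantumFieldTheory.BalabanImbrieJaffe1984to88.BIJ85Sect2SurfaceAverages

open Finset

/-- The two-scale bond geometry of Sect. 2, p. 303–304 [PDF 5–6]: fine lattice sites `X` (T₁, resp. T_η in Sect. 4.5) with
bonds `FB` (endpoints `src`, `tgt`), coarse lattice sites `Y` (the L-lattice, resp. the unit lattice) with bonds `CB`, the block map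
`blk` (x ∈ B(blk x); Fig. 1 p. 304: "Let B(y) denote a block with L = 4"), the block size `L` (≥ 1) and the dimension `d` (≥ 1).
Printed geometric facts carried as fields: a coarse bond is determined by its ordered endpoints (`cbond_ext`) and has distinct
endpoints (`cbond_ne`). [cite: BalabanImbrieJaffe1985, (2.15) p.304] -/
structure BlockBonds where
  /-- fine sites -/
  X : Type
  /-- coarse sites -/
  Y : Type
  /-- fine bonds -/
  FB : Type
  /-- coarse bonds -/
  CB : Type
  [fbFintype : Fintype FB]
  [cbFintype : Fintype CB]
  [fbDecEq : DecidableEq FB]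
  [yDecEq : DecidableEq Y]
  /-- b₋ -/
  src : FB → X
  /-- b₊ -/
  tgt : FB → X
  /-- b′₋ -/
  csrc : CB → Y
  /-- b′₊ -/
  ctgt : CB → Y
  /-- x ↦ the y with x ∈ B(y) -/
  blk : X → Y
  /-- block size (L, or L^k in Sect. 4.5) -/
  L : ℕ
  /-- dimension -/
  d : ℕ
  one_le_L : 1 ≤ L
  one_le_d : 1 ≤ d
  cbond_ext : ∀ c c' : CB, csrc c = csrc c' → ctgt c = ctgt c' → c = c'
  cbond_ne : ∀ c : CB, csrc c ≠ ctgt c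

namespace BlockBonds

variable (G : BlockBonds)

/-- the bundled finiteness of the fine bonds, as an instance (plumbing; API for (2.15)–(2.18)). [cite: BalabanImbrieJaffe1985, (2.15) p.304] -/
instance instFintypeFB : Fintype G.FB := G.fbFintype

/-- the bundled finiteness of the coarse bonds, as an instance (plumbing; API for (2.15)–(2.18)). [cite: BalabanImbrieJaffe1985, (2.15) p.304] -/
instance instFintypeCB : Fintype G.CB := G.cbFintype

/-- the bundled decidable equality of fine bonds, as an instance (plumbing; API for (2.15)–(2.18)). [cite: BalabanImbrieJaffe1985, (2.15) p.304] -/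
instance instDecEqFB : DecidableEq G.FB := G.fbDecEq

/-- the bundled decidable equality of coarse sites, as an instance (plumbing; API for (2.15)–(2.18)). [cite: BalabanImbrieJaffe1985, (2.15) p.304] -/
instance instDecEqY : DecidableEq G.Y := G.yDecEq

/-- **(2.15)** p. 304 [PDF 6], verbatim: *"Define the set of surface bonds B^s(b′) for an L-lattice bond b′ as follows:
B^s(b′) = {b : b = (b₋, b₊), b₋ ∈ B(b′₋), b₊ ∈ B(b′₊)} (2.15) (see Fig. 1)."* [cite: BalabanImbrieJaffe1985, (2.15) p.304] -/
def Bs (c : G.CB) : Finset G.FB :=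
  Finset.univ.filter fun b => G.blk (G.src b) = G.csrc c ∧ G.blk (G.tgt b) = G.ctgt c

/-- kernel: membership in B^s(b′). [cite: BalabanImbrieJaffe1985, (2.15) p.304] -/
theorem mem_Bs (c : G.CB) (b : G.FB) : b ∈ G.Bs c ↔ G.blk (G.src b) = G.csrc c ∧ G.blk (G.tgt b) = G.ctgt c := by
  simp [Bs]

/-- kernel: a fine bond lies in the surface set of at most one coarse bond (a coarse bond is determined by its endpoints).
[cite: BalabanImbrieJaffe1985, (2.15) p.304] -/
theorem Bs_unique {c c' : G.CB} {b : G.FB} (h : b ∈ G.Bs c) (h' : b ∈ G.Bs c') : c = c' := by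
  rw [mem_Bs] at h h'
  exact G.cbond_ext c c' (h.1.symm.trans h'.1) (h.2.symm.trans h'.2)

/-- kernel: a bond "strictly contained in a block (both endpoints belong to the block)" (p. 312) lies in no surface set.
[cite: BalabanImbrieJaffe1985, (4.5.3) p.312] -/
theorem not_mem_Bs_of_interior {b : G.FB} (hb : G.blk (G.src b) = G.blk (G.tgt b)) (c : G.CB) : b ∉ G.Bs c := by
  rw [mem_Bs]
  rintro ⟨h1, h2⟩
  exact G.cbond_ne c (h1.symm.trans (hb.trans h2))

/-- **(2.16)** p. 304 [PDF 6], verbatim: *"Associated with the surface is the average (Q^sA)_{b′} = L^{−(d−1)} Σ_{b∈B^s(b′)} A_b. (2.16)"*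
[cite: BalabanImbrieJaffe1985, (2.16) p.304] -/
noncomputable def Qs (A : G.FB → ℝ) (c : G.CB) : ℝ :=
  ((G.L : ℝ) ^ (G.d - 1))⁻¹ * ∑ b ∈ G.Bs c, A b

/-- **(2.17)** p. 304 [PDF 6], verbatim: *"Then (Q^{s*}A)_b = LA_{b′} if b ∈ B^s(b′), 0 otherwise, (2.17) using the inner product
(2.14)."* — typed as the sum over coarse bonds b′ of the printed case expression (at most one term is non-zero, `Bs_unique`);
the printed two cases are `Qsstar_of_mem`, `Qsstar_of_not_mem`. [cite: BalabanImbrieJaffe1985, (2.17) p.304] -/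
noncomputable def Qsstar (B : G.CB → ℝ) (b : G.FB) : ℝ :=
  ∑ c : G.CB, if b ∈ G.Bs c then (G.L : ℝ) * B c else 0

/-- kernel, the first printed case of (2.17): (Q^{s*}A)_b = LA_{b′} if b ∈ B^s(b′). [cite: BalabanImbrieJaffe1985, (2.17) p.304] -/
theorem Qsstar_of_mem (B : G.CB → ℝ) {b : G.FB} {c : G.CB} (h : b ∈ G.Bs c) : G.Qsstar B b = G.L * B c := by
  classical
  unfold Qsstar
  rw [Finset.sum_eq_single c]
  · simp [h]
  · intro c' _ hne
    have : b ∉ G.Bs c' := fun h' => hne (G.Bs_unique h' h)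
    simp [this]
  · intro hc
    exact absurd (Finset.mem_univ c) hc

/-- kernel, the second printed case of (2.17): (Q^{s*}A)_b = 0 otherwise. [cite: BalabanImbrieJaffe1985, (2.17) p.304] -/
theorem Qsstar_of_not_mem (B : G.CB → ℝ) {b : G.FB} (h : ∀ c, b ∉ G.Bs c) : G.Qsstar B b = 0 := by
  unfold Qsstar
  exact Finset.sum_eq_zero fun c _ => by simp [h c]

/-- **(2.14)** p. 304 [PDF 6], verbatim: *"The natural inner product on functions on bonds is ⟨A,B⟩_a = Σ_b a^d A_b B_b. (2.14)"* —
for a finite bond set and spacing `a`. [cite: BalabanImbrieJaffe1985, (2.14) p.304] -/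
def innerBond {Bd : Type} [Fintype Bd] (a : ℝ) (d : ℕ) (A B : Bd → ℝ) : ℝ :=
  ∑ b : Bd, a ^ d * A b * B b

/-- kernel: (2.17) IS the adjoint of (2.16) for the inner products (2.14) with a = 1 on the fine (unit) lattice and a = L on the
L-lattice: ⟨Q^sA, B⟩_L = ⟨A, Q^{s*}B⟩_1 ("using the inner product (2.14)").  Uses 1 ≤ d, 1 ≤ L.
[cite: BalabanImbrieJaffe1985, (2.17) p.304] -/
theorem inner_Qs_eq_inner_Qsstar (A : G.FB → ℝ) (B : G.CB → ℝ) :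
    innerBond (G.L : ℝ) G.d (G.Qs A) B = innerBond 1 G.d A (G.Qsstar B) := by
  classical
  have hL : (G.L : ℝ) ≠ 0 := by
    have := G.one_le_L
    positivity
  have hpow : (G.L : ℝ) ^ G.d * ((G.L : ℝ) ^ (G.d - 1))⁻¹ = G.L := by
    have hd : G.d = (G.d - 1) + 1 := (Nat.sub_add_cancel G.one_le_d).symm
    rw [hd, pow_succ, Nat.add_sub_cancel]
    field_simp
  unfold innerBond Qs Qsstar
  simp only [one_pow, one_mul]
  have hL' : ∀ c : G.CB, (G.L : ℝ) ^ G.d * (((G.L : ℝ) ^ (G.d - 1))⁻¹ * ∑ b ∈ G.Bs c, A b) * B c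
      = ∑ b ∈ G.Bs c, (G.L : ℝ) * A b * B c := by
    intro c
    rw [← mul_assoc, hpow, Finset.mul_sum, Finset.sum_mul]
  have hR : ∀ b : G.FB, A b * ∑ c : G.CB, (if b ∈ G.Bs c then (G.L : ℝ) * B c else 0)
      = ∑ c : G.CB, (if b ∈ G.Bs c then (G.L : ℝ) * A b * B c else 0) := by
    intro b
    rw [Finset.mul_sum]
    refine Finset.sum_congr rfl fun c _ => ?_
    split_ifs <;> ring
  simp_rw [hL', hR]
  rw [Finset.sum_comm]
  refine Finset.sum_congr rfl fun c _ => ?_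
  rw [Finset.sum_ite_mem, Finset.univ_inter]

/-- **(2.18)** p. 304 [PDF 6], first identity, verbatim: *"Also Q^sQ^{s*} = LI, Q^{s*}Q^s = LP^s. (2.18)"* — PROVED from
(2.16)–(2.17) under the printed geometry's count |B^s(b′)| = L^{d−1} (an L-cube face has L^{d−1} surface bonds; explicit
hypothesis `hcard`). [cite: BalabanImbrieJaffe1985, (2.18) p.304] -/
theorem Qs_Qsstar (hcard : ∀ c : G.CB, (G.Bs c).card = G.L ^ (G.d - 1)) (B : G.CB → ℝ) (c : G.CB) :
    G.Qs (G.Qsstar B) c = G.L * B c := by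
  have hpowne : ((G.L : ℝ) ^ (G.d - 1)) ≠ 0 := by
    have := G.one_le_L
    positivity
  unfold Qs
  have h1 : ∑ b ∈ G.Bs c, G.Qsstar B b = ∑ b ∈ G.Bs c, (G.L : ℝ) * B c :=
    Finset.sum_congr rfl fun b hb => G.Qsstar_of_mem B hb
  rw [h1, Finset.sum_const, hcard, nsmul_eq_mul]
  push_cast
  rw [← mul_assoc, inv_mul_cancel₀ hpowne, one_mul]

/-- The surface projection P^s of (2.18) p. 304 [PDF 6]: (P^sA)_b = L^{−(d−1)}Σ_{b″∈B^s(b′)}A_{b″} for b ∈ B^s(b′) (the average of A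
over the surface set containing b), 0 on bonds in no surface set — the operator for which the second identity of (2.18),
Q^{s*}Q^s = LP^s, holds (`Qsstar_Qs`); print does not display P^s separately. [cite: BalabanImbrieJaffe1985, (2.18) p.304] -/
noncomputable def Ps (A : G.FB → ℝ) (b : G.FB) : ℝ :=
  ∑ c : G.CB, if b ∈ G.Bs c then ((G.L : ℝ) ^ (G.d - 1))⁻¹ * ∑ b' ∈ G.Bs c, A b' else 0

/-- **(2.18)** p. 304 [PDF 6], second identity: Q^{s*}Q^s = LP^s — PROVED (definitional with `Ps`).
[cite: BalabanImbrieJaffe1985, (2.18) p.304] -/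
theorem Qsstar_Qs (A : G.FB → ℝ) (b : G.FB) : G.Qsstar (G.Qs A) b = G.L * G.Ps A b := by
  unfold Qsstar Ps Qs
  rw [Finset.mul_sum]
  refine Finset.sum_congr rfl fun c _ => ?_
  split_ifs <;> ring

/-! ## (4.5.1)–(4.5.3): the group-valued pull-back Q_k^{s*}v (Sect. 4.5, p. 312) -/

/-- **(4.5.1)** p. 312 [PDF 14], verbatim: *"We can represent an arbitrary v as v_b = exp(ie_kB_b), (4.5.1) where B_b = (ie_k)^{−1}ln v_b,
and the branch of the logarithm was chosen in (2.11)."* — the U(1)-valued unit-lattice bond field of the Lie-algebra field B (here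
the coarse bonds of the k-fold geometry `G`: block size L^k). [cite: BalabanImbrieJaffe1985, (4.5.1) p.312] -/
noncomputable def groupField (e : ℝ) (B : G.CB → ℝ) (c : G.CB) : ℂ :=
  Complex.exp (Complex.I * ((e : ℂ) * (B c : ℂ)))

/-- **(4.5.2)** p. 312 [PDF 14], verbatim: *"Then we extend the definition Q_s^* [sic] from the Lie algebra to group variables v by
the definition (Q_k^{s*}v)_b = exp((ie_kηQ_k^{s*}B)_b), b ∈ T_η. (4.5.2)"* — with `G` the k-fold geometry (fine = T_η, coarse =
unit lattice, block size `G.L` = L^k) and `G.Qsstar` = Q_k^{s*} ("Q_k is given by the formula (2.13), where L is replaced by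
L^k", p. 309; likewise for Q^{s*}). [cite: BalabanImbrieJaffe1985, (4.5.2) p.312] -/
noncomputable def QsstarGroup (e η : ℝ) (B : G.CB → ℝ) (b : G.FB) : ℂ :=
  Complex.exp (Complex.I * ((e : ℂ) * (η : ℂ) * (G.Qsstar B b : ℂ)))

/-- **(4.5.3)** p. 312 [PDF 14], first case, verbatim: *"This raises the question of what happens if we choose another branch of the
logarithm. The independence of the resulting transformation on this choice follows from the equivalent definition:
(Q_k^{s*}v)_b = 1 if b is strictly contained in a k-block (both endpoints belong to the block)"* — PROVED from (4.5.2).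
[cite: BalabanImbrieJaffe1985, (4.5.3) p.312] -/
theorem eq453_interior (e η : ℝ) (B : G.CB → ℝ) {b : G.FB} (hb : G.blk (G.src b) = G.blk (G.tgt b)) :
    G.QsstarGroup e η B b = 1 := by
  unfold QsstarGroup
  rw [G.Qsstar_of_not_mem B (G.not_mem_Bs_of_interior hb)]
  simp

/-- **(4.5.3)** p. 312 [PDF 14], second case, verbatim: *"(Q_k^{s*}v)_b = v_c if the η-lattice bond b belongs to the corridor of
bonds connecting the two blocks B^k(c₋) and B^k(c₊). Here c is a unit lattice bond. (4.5.3)"* — PROVED from (4.5.2), (2.17)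
(factor L^k) and ηL^k = 1 (hypothesis `hη`; η = L^{−k}).  This is the object [Balaban1988Convergent] (1.3) p. 246 recalls as
"(Q₁^{s*}V)(b) = 1 for b ⊂ B(y), V(c) for b ∈ B(c)". [cite: BalabanImbrieJaffe1985, (4.5.3) p.312] -/
theorem eq453_corridor (e η : ℝ) (hη : η * G.L = 1) (B : G.CB → ℝ) {b : G.FB} {c : G.CB} (h : b ∈ G.Bs c) :
    G.QsstarGroup e η B b = G.groupField e B c := by
  unfold QsstarGroup groupField
  rw [G.Qsstar_of_mem B h]
  have h1 : ((η * G.L : ℝ) : ℂ) = 1 := by rw [hη]; simp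
  push_cast at h1 ⊢
  congr 1
  calc Complex.I * ((e : ℂ) * (η : ℂ) * ((G.L : ℂ) * (B c : ℂ)))
      = Complex.I * ((e : ℂ) * (B c : ℂ)) * ((η : ℂ) * (G.L : ℂ)) := by ring
    _ = Complex.I * ((e : ℂ) * (B c : ℂ)) := by rw [h1, mul_one]

/-! ## v1.1 (append-only): (4.5.4) — the background field u_k (Sect. 4.5, p. 313) -/

/-- **(4.5.4)** p. 313 [PDF 15], verbatim: *"Now we define (u_k)_b = (Q^{s*}_kv)_b exp[−ie_kη(𝒟_k∂^*Q^{e*}_kf^{(k)})_b]. (4.5.4) This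
field configuration u_k is the minimal configuration for the approximate action, up to a gauge transformation. It serves as the
background field (external gauge field) in the expressions for the scalar field action and propagators."* — over the k-fold geometry
`G` (fine = T_η, coarse = unit lattice), with v = exp(ie_kB) as in (4.5.1) (`groupField`), (Q^{s*}_kv)_b as in (4.5.2) (`QsstarGroup`),
and `X` = the real η-lattice bond field 𝒟_k∂^*Q^{e*}_kf^{(k)} ((4.4.4) applied to ∂^*Q^{e*}_kf^{(k)}; supplied — its operators live in
Sects. 4.2–4.4, not in `BlockBonds`).  The minimality sentence is prose here (Sect. 5 / (6.2.1) make it precise).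
[cite: BalabanImbrieJaffe1985, (4.5.4) p.313] -/
noncomputable def backgroundField (e η : ℝ) (B : G.CB → ℝ) (X : G.FB → ℝ) (b : G.FB) : ℂ :=
  G.QsstarGroup e η B b * Complex.exp (-(Complex.I * ((e : ℂ) * (η : ℂ) * (X b : ℂ))))

/-- kernel, (4.5.4) in Lie-algebra form: (u_k)_b = exp(ie_kη((Q^{s*}_kB)_b − X_b)) — PROVED from (4.5.2).
[cite: BalabanImbrieJaffe1985, (4.5.4) p.313] -/
theorem backgroundField_eq_exp (e η : ℝ) (B : G.CB → ℝ) (X : G.FB → ℝ) (b : G.FB) :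
    G.backgroundField e η B X b = Complex.exp (Complex.I * ((e : ℂ) * (η : ℂ) * ((G.Qsstar B b : ℂ) - (X b : ℂ)))) := by
  unfold backgroundField QsstarGroup
  rw [← Complex.exp_add]
  congr 1
  ring

/-- kernel: u_k is a U(1)-valued bond field, ∣(u_k)_b∣ = 1. [cite: BalabanImbrieJaffe1985, (4.5.4) p.313] -/
theorem norm_backgroundField (e η : ℝ) (B : G.CB → ℝ) (X : G.FB → ℝ) (b : G.FB) : ‖G.backgroundField e η B X b‖ = 1 := by
  rw [backgroundField_eq_exp, Complex.norm_exp]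
  simp

/-- kernel, (4.5.4) with the first case of (4.5.3) inserted: on a bond strictly inside a k-block, (u_k)_b = exp[−ie_kηX_b].
[cite: BalabanImbrieJaffe1985, (4.5.4) p.313] -/
theorem backgroundField_interior (e η : ℝ) (B : G.CB → ℝ) (X : G.FB → ℝ) {b : G.FB} (hb : G.blk (G.src b) = G.blk (G.tgt b)) :
    G.backgroundField e η B X b = Complex.exp (-(Complex.I * ((e : ℂ) * (η : ℂ) * (X b : ℂ)))) := by
  unfold backgroundField
  rw [G.eq453_interior e η B hb, one_mul]

/-- kernel, (4.5.4) with the second case of (4.5.3) inserted: on a corridor bond b ∈ B^s(c), (u_k)_b = v_c exp[−ie_kηX_b]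
(ηL^k = 1, hypothesis `hη`). [cite: BalabanImbrieJaffe1985, (4.5.4) p.313] -/
theorem backgroundField_corridor (e η : ℝ) (hη : η * G.L = 1) (B : G.CB → ℝ) (X : G.FB → ℝ) {b : G.FB} {c : G.CB}
    (h : b ∈ G.Bs c) :
    G.backgroundField e η B X b = G.groupField e B c * Complex.exp (-(Complex.I * ((e : ℂ) * (η : ℂ) * (X b : ℂ)))) := by
  unfold backgroundField
  rw [G.eq453_corridor e η hη B h]

end BlockBonds

end Literature.MathematicalPhysics.QuantumFieldTheory.BalabanImbrieJaffe1984to88.BIJ85Sect2SurfaceAverages
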